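import Summits.FinalStateConjecture.FinalStateConjecture.Theorems.EIHFluxBalanceInertialRecessionStubRechart3Package
import Summits.FinalStateConjecture.FinalStateConjecture.Theorems.EIHFluxBalanceInertialRecessionStubRechart3Flat
import Summits.FinalStateConjecture.FinalStateConjecture.Theorems.EIHFluxBalanceInertialRecessionStubRechart3BoostTransport
import Summits.FinalStateConjecture.FinalStateConjecture.Theorems.EIHFluxBalanceInertialRecessionStubRechart3Frames
import Summits.FinalStateConjecture.FinalStateConjecture.Theorems.EIHFluxBalanceInertialRecessionGrowingRadius

/-!
# Route EIHFluxBalance — `InertialRecession`, re-charting: the analytic part (G1) from the stub's data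

Helper file for the crux `stmt-FinalStateConjecture-10166`
(`Summit.FinalStateConjecture.FinalStateConjecture.Theses.EIHFluxBalance.InertialRecession`),
line `sublinear-is-free-clean-window-charges`, stub `stub_rechart` (the transfer P2), part G1.

`rechart_analytic_package` — from EXACTLY the hypotheses of `stub_rechart` (subextremal holes,
bounded Lorentz factors, smooth painted motions, separation, Cesàro sublinearity, the lab chart with
its late-region open embedding and `C³` deviation decay, the output `Slaved³` of the slaving stub and
the Cesàro velocities) PLUS the orientation hypothesis `0 < (Λᵢe₀)⁰` (see the worker's mis-statement
report), this file produces all ANALYTIC ingredients of the sought `FinalStateDecomposition`: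
final velocities `Vᵢ` (`‖Vᵢ‖ ≤ κ² < 1`), for every hole a re-charting map `Aᵢ` (smooth open
embedding of `E4`, late, inside the lab domain on the rest exterior) whose boosted chart
`Φ ∘ Aᵢ ∘ boost(Vᵢ)⁻¹` converges in `C²` to boosted Kerr `(Mᵢ, aᵢ)` on every truncated slab, and the
radiation-zone package for every spin, for a PRESCRIBED flat profile `R'` (continuous, `→ ∞`,
sublinear, above `1 + Σ|rinᵢ| + Σ|aᵢ| + Σ r₊ᵢ`; to be meshed with the hole charts by the assembler). Inputs: `exists_normalisedFrame'` (…Frames),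
`clockChart_package` (…Package), `tendsto_truncDeviationCk_boostTransport` (…BoostTransport),
`flat_radiationZone_package_general` (…Flat). [folklore]
-/

noncomputable section

set_option linter.dupNamespace false

open Set Filter Function Metric Topology TopologicalSpace
open scoped ContDiff Manifold ENNReal BigOperators
open Literature.Geometry.Lorentzian

namespace Summit.FinalStateConjecture.FinalStateConjecture.Theorems.SublinearIsFree.Rechart

/-- A Cesàro velocity of a `κ²`-sublinear centre has norm `≤ κ²`. [folklore] -/
theorem norm_cesaro_le {ξ : ℝ → E3} {V : E3} {κ : ℝ} (hV : Tendsto (fun t : ℝ ↦ t⁻¹ • ξ t) atTop (𝓝 V))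
    (hξ : ∀ᶠ t in atTop, ‖ξ t‖ ≤ κ ^ 2 * t) : ‖V‖ ≤ κ ^ 2 := by
  refine le_of_tendsto (hV.norm) ?_
  filter_upwards [hξ, eventually_gt_atTop (0 : ℝ)] with t ht ht0
  rw [norm_smul, norm_inv, Real.norm_eq_abs, abs_of_pos ht0]
  rw [inv_mul_le_iff₀ ht0]
  linarith

-- the assembly is long
set_option maxHeartbeats 1600000 in
/-- **The analytic part of `stub_rechart`.** See the module docstring. [folklore] -/
theorem rechart_analytic_package (𝓢 : Spacetime 4) {N : ℕ} (M a rin : Fin N → ℝ)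
    (Λ : Fin N → ℝ → lorentzGroup) (ξ : Fin N → ℝ → E3) (γ κ τ₀ : ℝ) (U : Opens E4) (Φ : U → 𝓢.carrier)
    (hsub : ∀ i, Kerr.IsSubextremal (M i) (a i) ∧ Kerr.rMinus (M i) (a i) < rin i ∧ rin i < Kerr.rPlus (M i) (a i))
    (hγ : ∀ i t, |((Λ i t : E4 ≃L[ℝ] E4) (E4.basisVector 0)) 0| ≤ γ)
    (hsm : ∀ i, ContDiff ℝ ∞ (ξ i) ∧ ContDiff ℝ ∞ (fun t ↦ ((Λ i t : E4 ≃L[ℝ] E4) : E4 →L[ℝ] E4)))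
    (hsep : ∀ i j, i ≠ j → Tendsto (fun t ↦ ‖ξ i t - ξ j t‖) atTop atTop)
    (hκ : 0 < κ ∧ κ < 1 ∧ ∀ i, ∀ᶠ t in atTop, ‖ξ i t‖ ≤ κ ^ 2 * t)
    (hU : {x : E4 | τ₀ < x 0 ∧ ∀ i, rin i < Kerr.radius (a i)
      (poincareInv (Λ i (x 0)) (E4.ofTimeSpace (x 0) (ξ i (x 0))) x)} ⊆ (U : Set E4))
    (hΦ : ContMDiff 𝓘(ℝ, E4) (𝓡 4) ∞ Φ)
    (hemb : Topology.IsOpenEmbedding (((⟨U, fun x ↦ Minkowski.bilin +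
      ∑ i, (boostedKerrBilin (Λ i (x 0)) (E4.ofTimeSpace (x 0) (ξ i (x 0))) (M i) (a i) x -
        Minkowski.bilin), fun x ↦ x 0, E4.spatialNorm⟩ : ModelBackground).lateRegion τ₀).restrict Φ))
    (hdev : Tendsto (fun t ↦ 𝓢.deviationCk ⟨U, fun x ↦ Minkowski.bilin +
      ∑ i, (boostedKerrBilin (Λ i (x 0)) (E4.ofTimeSpace (x 0) (ξ i (x 0))) (M i) (a i) x -
        Minkowski.bilin), fun x ↦ x 0, E4.spatialNorm⟩ Φ 3 t) atTop (𝓝 0))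
    (Slaved : ∀ i : Fin N, (∀ m : ℕ, 1 ≤ m → m ≤ 3 → Tendsto (fun t ↦ iteratedDeriv m
        (fun s ↦ ((Λ i s : E4 ≃L[ℝ] E4) (E4.basisVector 0))) t) atTop (𝓝 0)) ∧
      (∀ m : ℕ, m ≤ 2 → Tendsto (fun t ↦ iteratedDeriv m (fun s ↦ deriv (ξ i) s -
        ((((Λ i s : E4 ≃L[ℝ] E4) (E4.basisVector 0)) 0)⁻¹ •
          E4.spatial ((Λ i s : E4 ≃L[ℝ] E4) (E4.basisVector 0)))) t) atTop (𝓝 0)) ∧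
      (a i ≠ 0 → ∀ m : ℕ, 1 ≤ m → m ≤ 3 → Tendsto (fun t ↦ iteratedDeriv m
        (fun s ↦ ((Λ i s : E4 ≃L[ℝ] E4) (E4.basisVector 3))) t) atTop (𝓝 0)))
    (CES : ∀ i : Fin N, ∃ V : E3, Tendsto (fun t : ℝ ↦ t⁻¹ • ξ i t) atTop (𝓝 V))
    (hpos : ∀ i t, 0 < ((Λ i t : E4 ≃L[ℝ] E4) (E4.basisVector 0)) 0)
    {R' : ℝ → ℝ} (hR'c : Continuous R')
    (hR'R₀ : ∀ t, 1 + ∑ i, |rin i| + ∑ i, |a i| + ∑ i, Kerr.rPlus (M i) (a i) ≤ R' t)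
    (hR'top : Tendsto R' atTop atTop) (hR'div : Tendsto (fun t ↦ R' t / t) atTop (𝓝 0)) :
    ∃ (V : Fin N → E3) (hV1 : ∀ i, ‖V i‖ < 1) (A : Fin N → E4 → E4)
      (hAU : ∀ i, ∀ y ∈ boostedKerrExterior 1 0 (M i) (a i), A i y ∈ U),
      (∀ i, ‖V i‖ ≤ κ ^ 2) ∧
      (∀ i, ContDiff ℝ ∞ (A i) ∧ Topology.IsOpenEmbedding (A i) ∧ (∀ y, τ₀ < A i y 0) ∧
        (∀ y ∈ boostedKerrExterior 1 0 (M i) (a i), ∀ j, Kerr.rPlus (M j) (a j) <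
          Kerr.radius (a j) (poincareInv (Λ j (A i y 0)) (E4.ofTimeSpace (A i y 0) (ξ j (A i y 0))) (A i y)))) ∧
      (∀ i (R : ℝ), Tendsto (fun τ ↦ 𝓢.truncDeviationCk
        (boostedKerrBackground (Lorentz.boost (V i) (hV1 i)) 0 (M i) (a i))
        (boostChart (Lorentz.boost (V i) (hV1 i)) (M i) (a i) (fun y ↦ Φ ⟨A i y.1, hAU i y.1 y.2⟩)) 2 R τ)
          atTop (𝓝 0)) ∧
      (∃ Rg : Fin N → ℝ → ℝ, (∀ i, Tendsto (Rg i) atTop atTop) ∧ ∀ i, Tendsto (fun τ ↦ 𝓢.truncDeviationCk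
        (boostedKerrBackground (Lorentz.boost (V i) (hV1 i)) 0 (M i) (a i))
        (boostChart (Lorentz.boost (V i) (hV1 i)) (M i) (a i) (fun y ↦ Φ ⟨A i y.1, hAU i y.1 y.2⟩)) 2 (Rg i τ) τ)
          atTop (𝓝 0)) ∧
      ∃ (U₀ : Opens E4) (hU₀ : U₀ ≤ U) (ρ : Fin N → ℝ → ℝ),
        (U₀ : Set E4) = {x : E4 | max τ₀ 0 + 1 < x 0 ∧ ∀ i, R' (x 0) < ‖E4.spatial x - ξ i (x 0)‖} ∧
        (∀ x ∈ (U₀ : Set E4), ∀ i, Kerr.rPlus (M i) (a i) <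
          Kerr.radius (a i) (poincareInv (Λ i (x 0)) (E4.ofTimeSpace (x 0) (ξ i (x 0))) x)) ∧
        (∀ i, Tendsto (fun t ↦ ρ i t / t) atTop (𝓝 0)) ∧
        {x : E4 | max τ₀ 0 + 1 < x 0 ∧ ∀ i, ρ i (x 0) <
          Kerr.radius (a i) (poincareInv (Lorentz.boost (V i) (hV1 i)) 0 x)} ⊆ (U₀ : Set E4) ∧
        Tendsto (fun t ↦ 𝓢.deviationCk (Minkowski.backgroundOn U₀) (Φ ∘ Opens.inclusion hU₀) 2 t)
          atTop (𝓝 0) ∧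
        Topology.IsOpenEmbedding (((Minkowski.backgroundOn U₀).lateRegion (max τ₀ 0 + 1)).restrict
          (Φ ∘ Opens.inclusion hU₀)) := by
  -- Lorentz factor floor
  set γ' : ℝ := max γ 1 with hγ'
  have hγ1 : 1 ≤ γ' := le_max_right _ _
  have hγ'b : ∀ i t, |((Λ i t : E4 ≃L[ℝ] E4) (E4.basisVector 0)) 0| ≤ γ' := fun i t ↦ (hγ i t).trans (le_max_left _ _)
  -- normalised frames
  have hnorm : ∀ i, ∃ Λ' : ℝ → lorentzGroup, ContDiff ℝ ∞ (fun t ↦ ((Λ' t : E4 ≃L[ℝ] E4) : E4 →L[ℝ] E4)) ∧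
      (∀ t, (Λ' t : E4 ≃L[ℝ] E4) (E4.basisVector 0) = (Λ i t : E4 ≃L[ℝ] E4) (E4.basisVector 0)) ∧
      (∀ m, 1 ≤ m → m ≤ 3 → Tendsto (fun t ↦ iteratedDeriv m
        (fun s ↦ ((Λ' s : E4 ≃L[ℝ] E4) : E4 →L[ℝ] E4)) t) atTop (𝓝 0)) ∧
      (∀ t c x, boostedKerrBilin (Λ i t) c (M i) (a i) x = boostedKerrBilin (Λ' t) c (M i) (a i) x) ∧
      (∀ t c x, Kerr.radius (a i) (poincareInv (Λ i t) c x) = Kerr.radius (a i) (poincareInv (Λ' t) c x)) :=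
    fun i ↦ exists_normalisedFrame' (Λ i) γ' (M i) (a i) (hsm i).2 (hγ'b i) (hpos i) (Slaved i).1 (Slaved i).2.2
  choose Λt hΛt he₀ hdec hbil' hrad' using hnorm
  have hbil : ∀ j t x, boostedKerrBilin (Λt j t) (E4.ofTimeSpace t (ξ j t)) (M j) (a j) x =
      boostedKerrBilin (Λ j t) (E4.ofTimeSpace t (ξ j t)) (M j) (a j) x := fun j t x ↦ (hbil' j t _ x).symm
  have hrad : ∀ j t x, Kerr.radius (a j) (poincareInv (Λt j t) (E4.ofTimeSpace t (ξ j t)) x) =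
      Kerr.radius (a j) (poincareInv (Λ j t) (E4.ofTimeSpace t (ξ j t)) x) := fun j t x ↦ (hrad' j t _ x).symm
  have huγ : ∀ j t, |((Λt j t : E4 ≃L[ℝ] E4) (E4.basisVector 0)) 0| ≤ γ' := fun j t ↦ by rw [he₀]; exact hγ'b j t
  have hpos' : ∀ j t, 0 < ((Λt j t : E4 ≃L[ℝ] E4) (E4.basisVector 0)) 0 := fun j t ↦ by rw [he₀]; exact hpos j t
  have hmis : ∀ j, ∀ m : ℕ, m ≤ 2 → Tendsto (fun t ↦ iteratedDeriv m (fun s ↦ deriv (ξ j) s -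
      ((((Λt j s : E4 ≃L[ℝ] E4) (E4.basisVector 0)) 0)⁻¹ •
        E4.spatial ((Λt j s : E4 ≃L[ℝ] E4) (E4.basisVector 0)))) t) atTop (𝓝 0) := by
    intro j m hm
    have h := (Slaved j).2.1 m hm
    simp only [he₀]
    exact h
  have hξ : ∀ j, ContDiff ℝ ∞ (ξ j) := fun j ↦ (hsm j).1
  have hΛ : ∀ j, ContDiff ℝ ∞ (fun t ↦ ((Λ j t : E4 ≃L[ℝ] E4) : E4 →L[ℝ] E4)) := fun j ↦ (hsm j).2
  -- the final velocities
  choose V hV using CES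
  have hVκ : ∀ i, ‖V i‖ ≤ κ ^ 2 := fun i ↦ norm_cesaro_le (hV i) (hκ.2.2 i)
  have hκ2 : κ ^ 2 < 1 := by nlinarith [hκ.1, hκ.2.1]
  have hV1 : ∀ i, ‖V i‖ < 1 := fun i ↦ (hVκ i).trans_lt hκ2
  -- the lab `C²` deviation
  set Bf : ModelBackground := ⟨U, fun x ↦ Minkowski.bilin +
      ∑ i, (boostedKerrBilin (Λ i (x 0)) (E4.ofTimeSpace (x 0) (ξ i (x 0))) (M i) (a i) x -
        Minkowski.bilin), fun x ↦ x 0, E4.spatialNorm⟩ with hBf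
  have hdev2 : Tendsto (fun t ↦ 𝓢.deviationCk Bf Φ 2 t) atTop (𝓝 0) :=
    tendsto_of_tendsto_of_tendsto_of_le_of_le tendsto_const_nhds hdev (fun _ ↦ bot_le)
      fun t ↦ 𝓢.deviationCk_mono Bf Φ (by norm_num) t
  -- the summands
  set H : Fin N → E4 → E4 →L[ℝ] E4 →L[ℝ] ℝ := fun j z ↦ boostedKerrBilin (Λ j (z 0))
    (E4.ofTimeSpace (z 0) (ξ j (z 0))) (M j) (a j) z - Minkowski.bilin with hH
  -- horizon radii
  have hrPlus : ∀ i, 0 < Kerr.rPlus (M i) (a i) := fun i ↦ by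
    have h1 : 0 < M i := (abs_nonneg (a i)).trans_lt (hsub i).1
    unfold Kerr.rPlus
    linarith [Real.sqrt_nonneg (M i ^ 2 - a i ^ 2)]
  -- the hole packages
  have hpack := fun i : Fin N ↦ clockChart_package 𝓢 i M a Λ ξ Λt hbil hrad (H := H) (fun j z ↦ rfl) (Bb := Bf.bilin)
    (fun z ↦ rfl) hΛ hξ hΛt hdec hγ1 huγ hpos' hmis (fun j hj ↦ hsep i j (Ne.symm hj)) U Φ hΦ hdev (hrin := fun j ↦ (hsub j).2.2)
    hU (hrPlus i) τ₀ le_rfl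
  choose T₀ ρ' C A hAU hP using hpack
  have hconvB : ∀ i (R : ℝ), Tendsto (fun τ ↦ 𝓢.truncDeviationCk
      (boostedKerrBackground (Lorentz.boost (V i) (hV1 i)) 0 (M i) (a i))
      (boostChart (Lorentz.boost (V i) (hV1 i)) (M i) (a i) (fun y ↦ Φ ⟨A i y.1, hAU i y.1 y.2⟩)) 2 R τ) atTop (𝓝 0) := by
    intro i R
    obtain ⟨-, -, -, -, -, -, -, -, -, -, -, -, hAc, -, -, -, -, -, -, -, hconv⟩ := hP i
    have hΨ₁ : ContMDiff 𝓘(ℝ, E4) (𝓡 4) ∞ (fun y : boostedKerrExterior 1 0 (M i) (a i) ↦ Φ ⟨A i y.1, hAU i y.1 y.2⟩) :=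
      contMDiff_comp_smooth (Ω := boostedKerrExterior 1 0 (M i) (a i)) hAc (hAU i) (fun _ ↦ rfl) hΦ
    exact tendsto_truncDeviationCk_boostTransport (Lorentz.boost (V i) (hV1 i)) (M i) (a i) _ hΨ₁ 2 R
      (hconv _ (fun _ ↦ rfl) R)
  refine ⟨V, hV1, A, hAU, hVκ, fun i ↦ ?_, hconvB, ?_, ?_⟩
  · obtain ⟨-, -, -, -, -, -, -, -, -, -, -, -, hAc, hemb', hlate, -, -, hradii, -, -, -⟩ := hP i
    exact ⟨hAc, hemb', hlate, hradii⟩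
  · -- growing certified radii (diagonal lemma)
    have hg : ∀ i, ∃ Rg : ℝ → ℝ, Tendsto Rg atTop atTop ∧ Tendsto (fun τ ↦ 𝓢.truncDeviationCk
        (boostedKerrBackground (Lorentz.boost (V i) (hV1 i)) 0 (M i) (a i))
        (boostChart (Lorentz.boost (V i) (hV1 i)) (M i) (a i) (fun y ↦ Φ ⟨A i y.1, hAU i y.1 y.2⟩)) 2 (Rg τ) τ)
          atTop (𝓝 0) := fun i ↦ by
      obtain ⟨Rg, -, hRt, hRc⟩ := exists_growing_radius' (f := fun τ r ↦ 𝓢.truncDeviationCk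
        (boostedKerrBackground (Lorentz.boost (V i) (hV1 i)) 0 (M i) (a i))
        (boostChart (Lorentz.boost (V i) (hV1 i)) (M i) (a i) (fun y ↦ Φ ⟨A i y.1, hAU i y.1 y.2⟩)) 2 r τ)
        fun n ↦ hconvB i n
      exact ⟨Rg, hRt, hRc⟩
    choose Rg hRg using hg
    exact ⟨Rg, fun i ↦ (hRg i).1, fun i ↦ (hRg i).2⟩
  · -- the flat package with the prescribed profile
    have hsum0 : 0 ≤ ∑ i, Kerr.rPlus (M i) (a i) := Finset.sum_nonneg fun i _ ↦ (hrPlus i).le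
    have hR'R₀' : ∀ t, 1 + ∑ i, |rin i| + ∑ i, |a i| ≤ R' t := fun t ↦ by linarith [hR'R₀ t]
    obtain ⟨U₀, hU₀, ρ, hU₀eq, hρ, hcov, hflat, hembf⟩ := flat_radiationZone_package_general 𝓢 M a rin Λ Λt ξ τ₀ U Φ
      hΦ hU hemb hdev2 hbil hΛt hdec hγ1 huγ hpos' hξ hmis V hV1 hV hR'c hR'R₀' hR'top hR'div
    refine ⟨U₀, hU₀, ρ, hU₀eq, fun x hx i ↦ ?_, hρ, hcov, hflat, hembf⟩
    -- far points have all painted radii above the horizon radii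
    rw [hU₀eq] at hx
    have h1 := hx.2 i
    have h2 := sub_abs_le_radius_poincareInv (Λ i (x 0)) (a i) (x := x) rfl (ξ i (x 0))
    have h3 : |a i| ≤ ∑ j, |a j| := Finset.single_le_sum (f := fun j ↦ |a j|) (fun _ _ ↦ abs_nonneg _) (Finset.mem_univ i)
    have h4 : Kerr.rPlus (M i) (a i) ≤ ∑ j, Kerr.rPlus (M j) (a j) :=
      Finset.single_le_sum (f := fun j ↦ Kerr.rPlus (M j) (a j)) (fun j _ ↦ (hrPlus j).le) (Finset.mem_univ i)
    have h5 : 0 ≤ ∑ j, |rin j| := Finset.sum_nonneg fun j _ ↦ abs_nonneg _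
    have h6 := hR'R₀ (x 0)
    change R' (x 0) < _ at h1
    linarith

/-- Registered one-line form (worker carrier `rechart_norm_cesaro_le`). [folklore] -/
theorem rechart_norm_cesaro_le : open Literature.Geometry.Lorentzian Filter Topology in ∀ {ξ : ℝ → E3} {V : E3} {κ : ℝ}, Tendsto (fun t : ℝ ↦ t⁻¹ • ξ t) atTop (𝓝 V) → (∀ᶠ t in atTop, ‖ξ t‖ ≤ κ ^ 2 * t) → ‖V‖ ≤ κ ^ 2 := fun hV hξ ↦ norm_cesaro_le hV hξ

end Summit.FinalStateConjecture.FinalStateConjecture.Theorems.SublinearIsFree.Rechart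

end
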